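import Summits.ResolutionOfSingularities.ResolutionOfSingularities.Theorems.FrobeniusClosingPatchingRelPerfectCoreRungTowerEuclid
import Summits.ResolutionOfSingularities.ResolutionOfSingularities.Theorems.FrobeniusClosingPatchingRelPerfectCoreRungTowerInitialForm
import HarnessLib

/-!
# Crux `PatchingRelPerfect` (stmt-ResolutionOfSingularities-16161), chain w52 — CORE RUNG r1τ,
# part 8: the EUCLIDEAN rungs — `(z)ᵃ + 𝔪ᵇ` for ALL `a ≤ b`, cone-form thickenings `(qᵃ) + 𝔪ᵐ`
# for ALL `m ≥ a · ord q`

[OURS · L1 W5.2 · rung r1τ] Local assembly of the ring-level Euclidean tower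
`CoreRungTower.euclid_exponents` (`…CoreRungTowerEuclid.lean`): after the point blow-up the ideals
below become `x_iᴺ · ((w)ᵅ + (x_iᵝ))` for a quasi-regular chart family `(x_i, w)` with regular
quotient, and the Euclidean tower finishes; companions `𝔪 · ∏_{(i,j) ∈ L(α,β)} (factor (i,j))`.
PROVED, every regular local `S` of every dimension:
* `companion_pow_span_castAdd_sup_pow_maximalIdeal_add`, `coreRung_…`, `…_rsopPart_…`, binder shape:
  **`(z₁, …, z_m)ᵃ + 𝔪ᵃ⁺ᵝ ∈ 𝒞` for ALL `a, β`** (`z` part of a regular system of parameters;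
  factors `(z)ⁱ + 𝔪ⁱ⁺ʲ`) — parts 2 (`a = 1`) and 6 (`a ∣ b`) were the sub-cases without Euclid;
* `companion_hypersurface_pow_sup_pow`, `coreRung_hypersurface_pow_sup_pow`: **`(qᵃ) + 𝔪^{da+β} ∈ 𝒞`
  for ALL `a, β`** for `q` with chartwise weak transforms `Q_i ∉ x_i B_i`, `B_i/(x_i, Q_i)` regular
  (part 4's data; factors `(qⁱ) + 𝔪^{di+j}`), and `companion_form_pow_sup_pow_add` /
  `coreRung_form_pow_sup_pow_add`: the same decided by the INITIAL FORM (part 5's data) — idea-2's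
  `ConeFormAtom` shape `(hᵃ) + 𝔪ᵐ` for every smooth cone form `h` of degree `d`, every `m ≥ da`
  (its example `(x₄ᵈ) + 𝔪ᵈ⁺¹`: `h = x₄`, `a = d`, `β = 1`).
FORMAT evidence for the core (CHAIN §1 (A)); nothing here is a statement of the manuscript.

## References

* Q. Liu, *Algebraic Geometry and Arithmetic Curves*, OUP 2002, Thm. 8.1.19 (a). [Liu2002]
* The Stacks Project, Tags 080A, 0804, 0BIQ. [StacksProject]
* O. Zariski, P. Samuel, *Commutative Algebra II*, Appendix 5. [ZariskiSamuel1960]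
-/

-- `Summit.<Summit>.<Sub>.Theorems` with `Sub = Summit` (single-conjunct summit, D-0017)
set_option linter.dupNamespace false

noncomputable section

open CategoryTheory CategoryTheory.Limits AlgebraicGeometry Literature.AlgebraicGeometry.Resolution

namespace Summit.ResolutionOfSingularities.ResolutionOfSingularities.Theorems

universe u

namespace CoreRungTower
/-- `M^{Σ n} ⊆ ∏ F` when each `M^{n p} ⊆ F p`. [folklore] -/
theorem pow_listSum_le_listProd {R : Type*} [CommSemiring R] (M : Ideal R) {ι : Type*} (L : List ι)
    (n : ι → ℕ) (F : ι → Ideal R) (h : ∀ p ∈ L, M ^ n p ≤ F p) :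
    M ^ (L.map n).sum ≤ (L.map F).prod := by
  induction L with
  | nil => simp only [List.map_nil, List.sum_nil, pow_zero, List.prod_nil]; exact le_rfl
  | cons p L ih =>
    rw [List.map_cons, List.map_cons, List.sum_cons, List.prod_cons, pow_add]
    exact Ideal.mul_mono (h p (by simp)) (ih fun p' hp' => h p' (List.mem_cons_of_mem p hp'))

/-- A list product of factors `⊤ⁱ ⊔ G` is the unit ideal. [folklore] -/
theorem listProd_top_pow_sup {R : Type*} [CommSemiring R] {ι : Type*} (L : List ι) (n : ι → ℕ)
    (G : ι → Ideal R) : (L.map fun p => (⊤ : Ideal R) ^ n p ⊔ G p).prod = ⊤ := by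
  induction L with
  | nil => rw [List.map_nil, List.prod_nil, Ideal.one_eq_top]
  | cons p L ih => rw [List.map_cons, List.prod_cons, ih, Ideal.top_pow, top_sup_eq, Ideal.top_mul]

/-! ## Chart images for the linear block `(z)ᵃ + 𝔪ᵃ⁺ʲ` on the point blow-up -/

section LinearBlockCharts

variable {S : Type u} [CommRing S] {m e : ℕ} (x : Fin (m + e) → S)

local notation3 "M" => Ideal.span (Set.range x)
local notation3 "Pz" => Ideal.span (Set.range fun j : Fin m => x (Fin.castAdd e j))

/-- `((z)ᵃ + 𝔪ᵃ⁺ʲ) · B_i = (x_iᵃ) · ((z/x_i)ᵃ + (x_iʲ))` on any chart. [cite: StacksProject, Tag 0804] -/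
theorem map_chartBase_blockFactor (i : Fin (m + e)) (a j : ℕ) :
    (Pz ^ a ⊔ M ^ (a + j)).map (chartBase x i) = Ideal.span {chartBase x i (x i) ^ a} *
      (Ideal.span (Set.range fun l : Fin m => chartGen x i (Fin.castAdd e l)) ^ a ⊔
        Ideal.span {chartBase x i (x i) ^ j}) := by
  have hP : (Pz).map (chartBase x i) = Ideal.span {chartBase x i (x i)} *
      Ideal.span (Set.range fun l : Fin m => chartGen x i (Fin.castAdd e l)) :=
    CoreRungTower.map_chartBase_span_comp x (Fin.castAdd e) i
  rw [Ideal.map_sup, Ideal.map_pow, hP, mul_pow, Ideal.span_singleton_pow, Ideal.map_pow,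
    map_reesChartBase_eq (x i) (Ideal.mem_span_range_self (f := x) (x := i)),
    Ideal.span_singleton_pow, pow_add, ← Ideal.span_singleton_mul_span_singleton, ← Ideal.mul_sup]

/-- Killed-direction chart: `((z)ᵃ + 𝔪ᵃ⁺ʲ) · B = (z_lᵃ)`. [cite: StacksProject, Tag 0804] -/
theorem map_chartBase_blockFactor_castAdd (l : Fin m) (a j : ℕ) :
    (Pz ^ a ⊔ M ^ (a + j)).map (chartBase x (Fin.castAdd e l)) =
      Ideal.span {chartBase x (Fin.castAdd e l) (x (Fin.castAdd e l)) ^ a} := by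
  rw [map_chartBase_blockFactor,
    CoreRungTower.span_chartGen_eq_top_of_eq x (Fin.castAdd e) (Fin.castAdd e l) l rfl,
    Ideal.top_pow, top_sup_eq, Ideal.mul_top]

/-- List version, killed direction. [cite: StacksProject, Tag 0804] -/
theorem map_chartBase_blockProd_castAdd (l : Fin m) (L : List (ℕ × ℕ)) :
    ((L.map fun p : ℕ × ℕ => Pz ^ p.1 ⊔ M ^ (p.1 + p.2)).prod).map
        (chartBase x (Fin.castAdd e l)) =
      Ideal.span {chartBase x (Fin.castAdd e l) (x (Fin.castAdd e l)) ^ (L.map Prod.fst).sum} := by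
  rw [map_listProd]
  simp_rw [map_chartBase_blockFactor_castAdd x l]
  exact listProd_span_pow _ L Prod.fst

/-- List version on any chart. [cite: StacksProject, Tag 0804] -/
theorem map_chartBase_blockProd (i : Fin (m + e)) (L : List (ℕ × ℕ)) :
    ((L.map fun p : ℕ × ℕ => Pz ^ p.1 ⊔ M ^ (p.1 + p.2)).prod).map (chartBase x i) =
      Ideal.span {chartBase x i (x i) ^ (L.map Prod.fst).sum} *
        (L.map fun p : ℕ × ℕ =>
          Ideal.span (Set.range fun l : Fin m => chartGen x i (Fin.castAdd e l)) ^ p.1 ⊔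
            Ideal.span {chartBase x i (x i) ^ p.2}).prod := by
  rw [map_listProd]
  simp_rw [map_chartBase_blockFactor x i]
  exact listProd_twist _ L Prod.fst _

end LinearBlockCharts

/-! ## Chart images for the cone-form family `(qᵃ) + 𝔪^{da+j}` -/

section FormCharts

variable {S : Type u} [CommRing S] {n : ℕ} (x : Fin n → S) (q : S) (d : ℕ) (i : Fin n)
  (Q : chartRing x i) (hQ : chartBase x i q = chartBase x i (x i) ^ d * Q)

include hQ in
/-- `((qᵃ) + 𝔪^{da+j}) · B_i = (x_i^{da}) · ((Q_i)ᵃ + (x_iʲ))`. [cite: StacksProject, Tag 0804] -/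
theorem map_chartBase_formFactor (a j : ℕ) :
    (Ideal.span {q ^ a} ⊔ Ideal.span (Set.range x) ^ (d * a + j)).map (chartBase x i) =
      Ideal.span {chartBase x i (x i) ^ (d * a)} *
        (Ideal.span (Set.range fun _ : Fin 1 => Q) ^ a ⊔ Ideal.span {chartBase x i (x i) ^ j}) := by
  have hqa : chartBase x i (q ^ a) = chartBase x i (x i) ^ (d * a) * Q ^ a := by rw [map_pow, hQ]; ring
  rw [Ideal.map_sup, Ideal.map_span, Set.image_singleton, hqa, Ideal.map_pow,
    map_reesChartBase_eq (x i) (Ideal.mem_span_range_self (f := x) (x := i)),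
    Ideal.span_singleton_pow, pow_add, Set.range_const, Ideal.span_singleton_pow,
    ← Ideal.span_singleton_mul_span_singleton, ← Ideal.span_singleton_mul_span_singleton,
    ← Ideal.mul_sup]

include hQ in
/-- List version. [cite: StacksProject, Tag 0804] -/
theorem map_chartBase_formProd (L : List (ℕ × ℕ)) :
    ((L.map fun p : ℕ × ℕ => Ideal.span {q ^ p.1} ⊔ Ideal.span (Set.range x) ^ (d * p.1 + p.2)).prod).map
        (chartBase x i) =
      Ideal.span {chartBase x i (x i) ^ (L.map fun p : ℕ × ℕ => d * p.1).sum} *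
        (L.map fun p : ℕ × ℕ =>
          Ideal.span (Set.range fun _ : Fin 1 => Q) ^ p.1 ⊔ Ideal.span {chartBase x i (x i) ^ p.2}).prod := by
  rw [map_listProd]
  simp_rw [map_chartBase_formFactor x q d i Q hQ]
  exact listProd_twist _ L (fun p : ℕ × ℕ => d * p.1) _

end FormCharts

end CoreRungTower

open CoreRungTower

/-! ## The linear block: `(z)ᵃ + 𝔪ᵃ⁺ᵝ ∈ 𝒞` for all `a, β` -/

section LinearBlockRung

variable {S : Type u} [CommRing S] [IsRegularLocalRing S] {m e : ℕ} (x : Fin (m + e) → S)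
  (hx : Ideal.span (Set.range x) = IsLocalRing.maximalIdeal S)
  (hd : (IsLocalRing.maximalIdeal S).spanFinrank = m + e)

local notation3 "Pz" => Ideal.span (Set.range fun j : Fin m => x (Fin.castAdd e j))

include hx hd in
/-- **`(z₁, …, z_m)ᵃ + 𝔪ᵃ⁺ᵝ` is in the companion class, for ALL `a, β`** (`z` the first block of a
regular system of parameters `x = (z, y)`): companion `𝔪 · ∏_{(i,j) ∈ L(a,β)} ((z)ⁱ + 𝔪ⁱ⁺ʲ)` with
the Euclidean tower as regular model (point blow-up; on the `y`-charts the chart family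
`(y, z/y)` runs `CoreRungTower.euclid_exponents`, the `z`-charts are Cartier).
[cite: Liu2002, Thm. 8.1.19 (a)] [cite: StacksProject, Tag 080A] [cite: ZariskiSamuel1960, App. 5] -/
theorem companion_pow_span_castAdd_sup_pow_maximalIdeal_add (a β : ℕ) :
    ∃ (Q : Ideal S) (m' : ℕ), IsLocalRing.maximalIdeal S ^ m' ≤ Q ∧
      ∃ (B : Scheme.{u}) (b : B ⟶ Spec (.of S)),
        IsBlowup b (affineBlowup.idealSheaf
          ((Pz ^ a ⊔ IsLocalRing.maximalIdeal S ^ (a + β)) * Q)) ∧ Scheme.IsRegular B := by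
  obtain ⟨L, hL⟩ := CoreRungTower.euclid_exponents.{u} a β
  haveI : IsRegularRing S := isRegularRing_of_isRegularLocalRing S
  haveI hres : IsRegularRing (S ⧸ Ideal.span (Set.range x)) := isRegularRing_quotient_span_rsop x hx
  have hxq : IsQuasiRegular x := isQuasiRegular_regularSystemOfParameters hd x hx
  set Q : Ideal S := IsLocalRing.maximalIdeal S *
    (L.map fun p : ℕ × ℕ => Pz ^ p.1 ⊔ IsLocalRing.maximalIdeal S ^ (p.1 + p.2)).prod with hQdef
  obtain ⟨B, b, hb⟩ := exists_isBlowup (Spec (.of S)) (affineBlowup.idealSheaf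
    ((Pz ^ a ⊔ IsLocalRing.maximalIdeal S ^ (a + β)) * Q))
  refine ⟨Q, 1 + (L.map fun p : ℕ × ℕ => p.1 + p.2).sum, ?_, B, b, hb, ?_⟩
  · rw [hQdef, pow_add, pow_one]
    exact Ideal.mul_mono_right (pow_listSum_le_listProd _ L _ _ fun p _ => le_sup_right)
  · -- regularity: point blow-up, then chart by chart
    rw [hQdef, mul_left_comm, ← hx] at hb
    rw [mul_comm] at hb
    refine isRegular_of_isBlowup_mul_of_charts x _ (fun i Y ρ hρ => ?_) hb
    haveI hB : IsRegularRing (chartRing x i) := isRegularRing_blowupChart x i hxq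
    have hti : chartBase x i (x i) ∈ nonZeroDivisors (chartRing x i) :=
      reesChartBase_mem_nonZeroDivisors (x i) (Ideal.mem_span_range_self (f := x) (x := i))
    rw [Ideal.map_mul, map_chartBase_blockFactor, map_chartBase_blockProd, mul_mul_mul_comm,
      Ideal.span_singleton_mul_span_singleton] at hρ
    refine CoreRungTower.isRegular_of_isBlowup_span_singleton_mul
      (mul_mem (pow_mem hti _) (pow_mem hti _)) _ (fun Y' ρ' hρ' => ?_) hρ
    induction i using Fin.addCases with
    | left l =>
      rw [CoreRungTower.span_chartGen_eq_top_of_eq x (Fin.castAdd e) (Fin.castAdd e l) l rfl,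
        Ideal.top_pow, top_sup_eq, Ideal.top_mul] at hρ'
      rw [listProd_top_pow_sup L Prod.fst, affineBlowup.idealSheaf_top] at hρ'
      haveI : IsIso ρ' := hρ'.isIso isEffectiveCartier_top
      haveI : IsRegularRing (CommRingCat.of (chartRing x (Fin.castAdd e l))) := hB
      exact SectionAscent.TraceIdeal.isRegular_of_iso (asIso ρ') (Scheme.isRegular_Spec _)
    | right k =>
      have hne : ∀ j : Fin m, Fin.castAdd e j ≠ Fin.natAdd m k := by
        intro j h
        have h' := congrArg Fin.val h
        rw [Fin.val_castAdd, Fin.val_natAdd] at h'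
        have := j.2
        omega
      let jJ : Fin m → {j : Fin (m + e) // j ≠ Fin.natAdd m k} := fun j => ⟨Fin.castAdd e j, hne j⟩
      have hjJ : Function.Injective jJ := fun j j' h =>
        Fin.castAdd_injective _ _ (congrArg Subtype.val h)
      have hx' := CoreRungTower.isQuasiRegular_chartFamily x (Fin.natAdd m k) jJ hxq hjJ
      have hR' := CoreRungTower.isRegularRing_quot_chartFamily x (Fin.natAdd m k) jJ hxq
      exact hL (chartBase x (Fin.natAdd m k) (x (Fin.natAdd m k)))
        (fun j : Fin m => chartGen x (Fin.natAdd m k) (Fin.castAdd e j)) hx' hR' hρ'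

include hx hd in
/-- **CORE RUNG r1τ — `(z)ᵃ + 𝔪ᵃ⁺ᵝ`, all exponents**: the blow-up-form core's conclusion for every
blowing up of `Spec S` along it. [cite: StacksProject, Tag 080A] [cite: ZariskiSamuel1960, App. 5] -/
theorem coreRung_pow_span_castAdd_sup_pow_maximalIdeal_add (a β : ℕ)
    (hI : Pz ^ a ⊔ IsLocalRing.maximalIdeal S ^ (a + β) ≠ ⊥) (T : Scheme.{u})
    (f : T ⟶ Spec (.of S))
    (hf : IsBlowup f (affineBlowup.idealSheaf (Pz ^ a ⊔ IsLocalRing.maximalIdeal S ^ (a + β)))) :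
    ∃ (J : T.IdealSheafData) (T' : Scheme.{u}) (π : T' ⟶ T), J ≠ ⊥ ∧
      (∀ t : T, t ∈ J.support → f.base t = IsLocalRing.closedPoint S) ∧
      IsBlowup π J ∧ Scheme.IsRegular T' :=
  atomConclusion_of_companion' hI (companion_pow_span_castAdd_sup_pow_maximalIdeal_add x hx hd a β)
    T f hf

end LinearBlockRung

/-- **`(z)ᵃ + 𝔪ᵇ ∈ 𝒞` for `z` part of a regular system of parameters (`IsRsopPart z`) and ALL
`a ≤ b`.** [cite: StacksProject, Tag 080A] [cite: ZariskiSamuel1960, App. 5] -/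
theorem companion_pow_span_rsopPart_sup_pow_maximalIdeal {S : Type u} [CommRing S]
    [IsRegularLocalRing S] {m : ℕ} {z : Fin m → S} (hz : IsRsopPart z) (a b : ℕ) (hab : a ≤ b) :
    ∃ (Q : Ideal S) (m' : ℕ), IsLocalRing.maximalIdeal S ^ m' ≤ Q ∧
      ∃ (B : Scheme.{u}) (b' : B ⟶ Spec (.of S)),
        IsBlowup b' (affineBlowup.idealSheaf
          ((Ideal.span (Set.range z) ^ a ⊔ IsLocalRing.maximalIdeal S ^ b) * Q)) ∧
        Scheme.IsRegular B := by
  obtain ⟨e, x, hd, hx, hxz⟩ := hz.exists_rsop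
  have hzx : (fun j : Fin m => x (Fin.castAdd e j)) = z := funext hxz
  subst hzx
  obtain ⟨β, rfl⟩ : ∃ β, b = a + β := ⟨b - a, by omega⟩
  exact companion_pow_span_castAdd_sup_pow_maximalIdeal_add x hx hd a β

/-- **CORE RUNG r1τ, coordinate-free: `(z)ᵃ + 𝔪ᵇ`, all `a ≤ b`** (`a > b`: the ideal is `𝔪ᵇ`,
rung r0). [cite: StacksProject, Tag 080A] [cite: ZariskiSamuel1960, App. 5] -/
theorem coreRung_pow_span_rsopPart_sup_pow_maximalIdeal {S : Type u} [CommRing S]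
    [IsRegularLocalRing S] {m : ℕ} {z : Fin m → S} (hz : IsRsopPart z) (a b : ℕ) (hab : a ≤ b)
    (hI : Ideal.span (Set.range z) ^ a ⊔ IsLocalRing.maximalIdeal S ^ b ≠ ⊥)
    (T : Scheme.{u}) (f : T ⟶ Spec (.of S))
    (hf : IsBlowup f (affineBlowup.idealSheaf
      (Ideal.span (Set.range z) ^ a ⊔ IsLocalRing.maximalIdeal S ^ b))) :
    ∃ (J : T.IdealSheafData) (T' : Scheme.{u}) (π : T' ⟶ T), J ≠ ⊥ ∧
      (∀ t : T, t ∈ J.support → f.base t = IsLocalRing.closedPoint S) ∧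
      IsBlowup π J ∧ Scheme.IsRegular T' :=
  atomConclusion_of_companion' hI (companion_pow_span_rsopPart_sup_pow_maximalIdeal hz a b hab) T f hf

/-- **The registered core's binder shape, restricted to `(z)ᵃ + 𝔪ᵇ`, `a ≤ b`** (hypotheses of
`stub_atomDimFourBlowup`; dimension, characteristic, completeness, residue field and the
off-fibre hypothesis unused). [cite: StacksProject, Tag 080A] -/
theorem atomDimFourBlowupAt_pow_span_rsopPart_sup_pow_maximalIdeal (p : ℕ) (_hp : p.Prime)
    (S : Type) [CommRing S] [IsRegularLocalRing S] [CharP S p]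
    [IsAdicComplete (IsLocalRing.maximalIdeal S) S]
    [PerfectField (IsLocalRing.ResidueField S)] (_hS : ringKrullDim S = (4 : ℕ))
    {m : ℕ} {z : Fin m → S} (hz : IsRsopPart z) (a b : ℕ) (hab : a ≤ b)
    (hI : Ideal.span (Set.range z) ^ a ⊔ IsLocalRing.maximalIdeal S ^ b ≠ ⊥)
    (T : Scheme.{0}) (f : T ⟶ Spec (.of S))
    (hf : IsBlowup f (affineBlowup.idealSheaf
      (Ideal.span (Set.range z) ^ a ⊔ IsLocalRing.maximalIdeal S ^ b)))
    (_hoff : ∀ t : T, f.base t ≠ IsLocalRing.closedPoint S →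
      IsRegularLocalRing (T.presheaf.stalk t)) :
    ∃ (J : T.IdealSheafData) (T' : Scheme.{0}) (π : T' ⟶ T), J ≠ ⊥ ∧
      (∀ t : T, t ∈ J.support → f.base t = IsLocalRing.closedPoint S) ∧
      IsBlowup π J ∧ Scheme.IsRegular T' :=
  coreRung_pow_span_rsopPart_sup_pow_maximalIdeal hz a b hab hI T f hf

/-! ## Cone forms: `(qᵃ) + 𝔪^{da+β} ∈ 𝒞` for all `a, β` -/

section FormRung

variable {S : Type u} [CommRing S] [IsRegularLocalRing S] {n : ℕ} (x : Fin n → S)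
  (hx : Ideal.span (Set.range x) = IsLocalRing.maximalIdeal S)
  (hd : (IsLocalRing.maximalIdeal S).spanFinrank = n)
  (q : S) (d : ℕ) (Q : ∀ i : Fin n, chartRing x i)
  (hQ : ∀ i, chartBase x i q = chartBase x i (x i) ^ d * Q i)
  (hnot : ∀ i, Q i ∉ Ideal.span {chartBase x i (x i)})
  (hreg : ∀ i, IsRegularRing (chartRing x i ⧸ Ideal.span {chartBase x i (x i), Q i}))

include hx hd hQ hnot hreg in
/-- **`(qᵃ) + 𝔪^{da+β} ∈ 𝒞 for ALL `a, β`** when `q = x_iᵈ Q_i` on every chart with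
`Q_i ∉ x_i B_i` and `B_i/(x_i, Q_i)` regular: companion `𝔪 · ∏_{(i,j)∈L(a,β)} ((qⁱ) + 𝔪^{di+j})`,
model the Euclidean tower of the chart pairs `(x_i, Q_i)`. [cite: Liu2002, Thm. 8.1.19 (a)]
[cite: StacksProject, Tag 080A] [cite: ZariskiSamuel1960, App. 5] -/
theorem companion_hypersurface_pow_sup_pow (a β : ℕ) :
    ∃ (P : Ideal S) (m' : ℕ), IsLocalRing.maximalIdeal S ^ m' ≤ P ∧
      ∃ (B : Scheme.{u}) (b : B ⟶ Spec (.of S)),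
        IsBlowup b (affineBlowup.idealSheaf
          ((Ideal.span {q ^ a} ⊔ IsLocalRing.maximalIdeal S ^ (d * a + β)) * P)) ∧
        Scheme.IsRegular B := by
  obtain ⟨L, hL⟩ := CoreRungTower.euclid_exponents.{u} a β
  haveI : IsRegularRing S := isRegularRing_of_isRegularLocalRing S
  haveI : (Ideal.span (Set.range x)).IsMaximal := hx ▸ IsLocalRing.maximalIdeal.isMaximal S
  letI := Ideal.Quotient.field (Ideal.span (Set.range x))
  haveI hres : IsRegularRing (S ⧸ Ideal.span (Set.range x)) := inferInstance
  have hxq : IsQuasiRegular x := isQuasiRegular_regularSystemOfParameters hd x hx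
  set P : Ideal S := IsLocalRing.maximalIdeal S *
    (L.map fun p : ℕ × ℕ => Ideal.span {q ^ p.1} ⊔
      IsLocalRing.maximalIdeal S ^ (d * p.1 + p.2)).prod with hPdef
  obtain ⟨B, b, hb⟩ := exists_isBlowup (Spec (.of S)) (affineBlowup.idealSheaf
    ((Ideal.span {q ^ a} ⊔ IsLocalRing.maximalIdeal S ^ (d * a + β)) * P))
  refine ⟨P, 1 + (L.map fun p : ℕ × ℕ => d * p.1 + p.2).sum, ?_, B, b, hb, ?_⟩
  · rw [hPdef, pow_add, pow_one]
    exact Ideal.mul_mono_right (pow_listSum_le_listProd _ L _ _ fun p _ => le_sup_right)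
  · rw [hPdef, mul_left_comm, ← hx] at hb
    rw [mul_comm] at hb
    refine isRegular_of_isBlowup_mul_of_charts x _ (fun i Y ρ hρ => ?_) hb
    haveI hB : IsRegularRing (chartRing x i) := isRegularRing_blowupChart x i hxq
    have hti : chartBase x i (x i) ∈ nonZeroDivisors (chartRing x i) :=
      reesChartBase_mem_nonZeroDivisors (x i) (Ideal.mem_span_range_self (f := x) (x := i))
    rw [Ideal.map_mul, map_chartBase_formFactor x q d i (Q i) (hQ i),
      map_chartBase_formProd x q d i (Q i) (hQ i), mul_mul_mul_comm,
      Ideal.span_singleton_mul_span_singleton] at hρ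
    refine CoreRungTower.isRegular_of_isBlowup_span_singleton_mul
      (mul_mem (pow_mem hti _) (pow_mem hti _)) _ (fun Y' ρ' hρ' => ?_) hρ
    have hx' : IsQuasiRegular (Fin.cons (chartBase x i (x i)) fun _ : Fin 1 => Q i) :=
      isQuasiRegular_of_isWeaklyRegular _ (CoreRungTower.isWeaklyRegular_chartPair x hx hd Q hnot i)
    have hR' := CoreRungTower.isRegularRing_quot_chartPair x Q hreg i
    rw [hx] at hres
    exact hL (chartBase x i (x i)) (fun _ : Fin 1 => Q i) hx' hR' hρ'

include hx hd hQ hnot hreg in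
/-- **CORE RUNG r1τ — cone-form thickenings `(qᵃ) + 𝔪^{da+β}`, all exponents** (chartwise weak
transforms `Q_i ∉ x_i B_i`, `B_i/(x_i, Q_i)` regular). [cite: StacksProject, Tag 080A] -/
theorem coreRung_hypersurface_pow_sup_pow (a β : ℕ)
    (hI : Ideal.span {q ^ a} ⊔ IsLocalRing.maximalIdeal S ^ (d * a + β) ≠ ⊥) (T : Scheme.{u})
    (f : T ⟶ Spec (.of S))
    (hf : IsBlowup f (affineBlowup.idealSheaf
      (Ideal.span {q ^ a} ⊔ IsLocalRing.maximalIdeal S ^ (d * a + β)))) :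
    ∃ (J : T.IdealSheafData) (T' : Scheme.{u}) (π : T' ⟶ T), J ≠ ⊥ ∧
      (∀ t : T, t ∈ J.support → f.base t = IsLocalRing.closedPoint S) ∧
      IsBlowup π J ∧ Scheme.IsRegular T' :=
  atomConclusion_of_companion' hI (companion_hypersurface_pow_sup_pow x hx hd q d Q hQ hnot hreg a β)
    T f hf

end FormRung

section FormRungInitialForm

variable {S : Type u} [CommRing S] [IsRegularLocalRing S] {n : ℕ} (x : Fin n → S)
  (hx : Ideal.span (Set.range x) = IsLocalRing.maximalIdeal S)
  (hd : (IsLocalRing.maximalIdeal S).spanFinrank = n)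
  {d : ℕ} (F : MvPolynomial (Fin n) S) (hF : F.IsHomogeneous d) (r : S)
  (hr : r ∈ IsLocalRing.maximalIdeal S ^ (d + 1))
  (hform : ∀ i : Fin n,
    MvPolynomial.aeval (fun j : Fin n => if h : j = i then
        (1 : MvPolynomial {j : Fin n // j ≠ i} (S ⧸ Ideal.span (Set.range x)))
      else MvPolynomial.X ⟨j, h⟩)
      (MvPolynomial.map (Ideal.Quotient.mk (Ideal.span (Set.range x))) F) ≠ 0 ∧
    IsRegularRing (MvPolynomial {j : Fin n // j ≠ i} (S ⧸ Ideal.span (Set.range x)) ⧸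
      Ideal.span {MvPolynomial.aeval (fun j : Fin n => if h : j = i then
          (1 : MvPolynomial {j : Fin n // j ≠ i} (S ⧸ Ideal.span (Set.range x)))
        else MvPolynomial.X ⟨j, h⟩)
        (MvPolynomial.map (Ideal.Quotient.mk (Ideal.span (Set.range x))) F)}))

include hx hd hF hr hform in
/-- **idea-2's `ConeFormAtom` shape in full: `(qᵃ) + 𝔪^{da+β} ∈ 𝒞` for `q = F(x) + r` with regular
projective tangent cone** (`F` a form of degree `d`, `r ∈ 𝔪ᵈ⁺¹`, `F̄_i ≠ 0` and
`κ[T_j : j ≠ i]/(F̄_i)` regular for every `i`), ALL `a, β` — e.g. `(x₄ᵈ) + 𝔪ᵈ⁺¹`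
(`F = X₄`, `a = d`, `β = 1`). [cite: StacksProject, Tag 080A] [cite: ZariskiSamuel1960, App. 5] -/
theorem companion_form_pow_sup_pow_add (a β : ℕ) :
    ∃ (P : Ideal S) (m' : ℕ), IsLocalRing.maximalIdeal S ^ m' ≤ P ∧
      ∃ (B : Scheme.{u}) (b : B ⟶ Spec (.of S)),
        IsBlowup b (affineBlowup.idealSheaf
          ((Ideal.span {(MvPolynomial.eval x F + r) ^ a} ⊔
            IsLocalRing.maximalIdeal S ^ (d * a + β)) * P)) ∧ Scheme.IsRegular B := by
  obtain ⟨Q, hQ, hnot, hreg⟩ := CoreRungTower.exists_chartData_of_form x hx hd F hF r hr hform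
  exact companion_hypersurface_pow_sup_pow x hx hd _ d Q hQ hnot hreg a β

include hx hd hF hr hform in
/-- **CORE RUNG r1τ — `ConeFormAtom`, all exponents**: `q = F(x) + r` with regular projective
tangent cone, every blowing up along `(qᵃ) + 𝔪^{da+β} ≠ 0`. [cite: StacksProject, Tag 080A] -/
theorem coreRung_form_pow_sup_pow_add (a β : ℕ)
    (hI : Ideal.span {(MvPolynomial.eval x F + r) ^ a} ⊔
      IsLocalRing.maximalIdeal S ^ (d * a + β) ≠ ⊥)
    (T : Scheme.{u}) (f : T ⟶ Spec (.of S))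
    (hf : IsBlowup f (affineBlowup.idealSheaf
      (Ideal.span {(MvPolynomial.eval x F + r) ^ a} ⊔ IsLocalRing.maximalIdeal S ^ (d * a + β)))) :
    ∃ (J : T.IdealSheafData) (T' : Scheme.{u}) (π : T' ⟶ T), J ≠ ⊥ ∧
      (∀ t : T, t ∈ J.support → f.base t = IsLocalRing.closedPoint S) ∧
      IsBlowup π J ∧ Scheme.IsRegular T' :=
  atomConclusion_of_companion' hI (companion_form_pow_sup_pow_add x hx hd F hF r hr hform a β) T f hf

end FormRungInitialForm

end Summit.ResolutionOfSingularities.ResolutionOfSingularities.Theorems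

end
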